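import Summits.QuantumFields.YangMills.Theorems.UnitScaleTiltProp7SymCentreOfAbelianSupplier
import HarnessLib

/-!
# Route `UnitScaleTilt`, crux K1 child «MinimiserStabilityRegPr» (stmt-QuantumFields-19200), stub `stub_existenceMinimalOrbit` (EX), line «SYM-CENTRE»
# (★★OWNER RULING g28-№7 cure (ii-a); RULING №8) — **«ROW-KNIT»: the DISPLAYED row `hSymCentre` of the EX display of record (✓`…TwS9PCtrR` :315–319,
# text hSymCentre-R of the EX namer's RULING 2026-08-28T22:08:41Z, opaque lift letter `Lift L i`, radius letter `CS`) FROM A PER-`L` DIAGONAL-LIFT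
# SUPPLIER — by name over the landed frame ✓`exists_symCentre_of_diagonalLiftSupplier` (✓p675211 §2), with the frame's windows `10⁷L³a ≤ 1`,
# `10⁷L³a′ ≤ 1`, `δ ≤ 2` discharged from ONE smallness `ε₁ ≤ aS` and the `CloseAvg` conjunct dropped**

Cell `ym3-torus`, width seat `ym3-torus-px20` (gen 3; the SYM-CENTRE line's base).  THEOREMS ONLY (0 `def`, 0 `sorry`).
`--supports stmt-QuantumFields-19200 --as helper`, count-neutral.  YM₃ on T³ is a ladder rung (R3), not the Clay problem; nothing here claims the stub,
the crux, d = 4 or the mass gap.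

THE POINT.  The supplier side of the line ((R3) smooth exact lift ★px19, FLUX kit ★w5-20520 g8, R4-FIBRE w4-20520 g9, R4-DICT∕CS-ARITH ★px19,
(R4) assembly ★px6 g3) ends with a statement PER FAMILY MEMBER `(F, n ≤ K)`: for every σ₃-diagonal case-A coarse `V′` with `PlaqSmall ε₁ V′`
(`ε₁ ≤ aF`) a σ₃-diagonal `U₁ ∈ fibre V′` with `RegPr (CF·ε₁) U₁`, the constants `aF, CF` depending on the block size `L` only.  The display's row is
quantified over the INDEX `T3Thm1Carrier.Idx L` with `∃ aS CS` chosen per `L` and the stub's antecedents `PlaqSmall ε₁ V`, `RegPr (L³·3L·ε₁) U₀`,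
`U₀ ∈ fibre V`.  This file is the bookkeeping between the two, once and for all:
* §1 ★★★`hSymCentreRow_of_diagonalLiftSupplierL` — generic lift letter `Lift` with a bridge `hLiftOf` from the hLift text of record (✓p665243 :277–282);
  constants `CS := max (L³·3L) CF`, `aS := min aF (min 2 (10⁷·L³·CS)⁻¹)`.
* §1 ★★`hSymCentreRow_of_abelianSupplierL` — the same over the §1 frame ✓`exists_symCentre_of_abelianSupplier` (supplier already returns the lift clause).
* §2 ★★★`hSymCentreRow_of_diagonalLiftSupplierL_record` — §1 at `Lift :=` the hLift text of record (the letter the EX knit instantiates), bridge `id`.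
HONEST SCOPE.  Composition of landed theorems and window arithmetic; no estimate; the per-`L` supplier hypothesis IS the open content of the line (★px6 g3's
(R4) assembly); no stub ∕ crux statement is advanced.  The DENSITY road (★px10 g3 ✓p677825, row `hIrrLift`) is independent of this file.

References: T. Bałaban, CMP 102 (1985) 277–309 [Balaban1985Variational] (Thm 1 p.279 «the constants depend on d and L only»; (2)–(7) p.278, (13)–(14)
p.280); CMP 99 (1985) 389–434 [Balaban1985BackgroundPropagators] ((3.19)–(3.21) pp.393–394); CMP 109 (1987) 249–301 [Balaban1987RG1] ((0.4), (0.11) p.253).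
-/

set_option autoImplicit false

noncomputable section

open scoped BigOperators Matrix.Norms.L2Operator Matrix

namespace Summit.QuantumFields.YangMills.Theorems.Prop7NestedMeanParallelLiftDiagGauge

open Literature.MathematicalPhysics.QuantumFieldTheory.Balaban1983to89
open T4Continuum BlockAveraging
open B10Eq27TorusAxialLog (unitsField toUField)
open B15DeterminingSets (embIter)
open B9AdOrthogonal (σ₃)
open Summit.QuantumFields.YangMills.Theorems.Prop8Chart (emlIterU)
open Literature.MathematicalPhysics.QuantumFieldTheory.Balaban1983to89.T3ContinuumYM3Torus
open T3UnitLawDensityEML (ℰp)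
open T3ConstrainedMinimiser (fibre)
open T3PrintedRegularMinimiser (RegPr)
open T3PrintedMinimiserExistence (regPr_mono)
open T3SectALandauChart (bgUnits CloseAvg)
open T3Thm1Carrier (Idx)

section T3

/-! ## §0 Window arithmetic (one smallness `ε₁ ≤ aS` feeds the frame's three windows) -/

/-- The radius bookkeeping of the row: with `CS ≥ L³·3L`, `CS > 0` and `ε₁ ≤ (10⁷·L³·CS)⁻¹`, both frame windows `10⁷·L³·(L³·3L·ε₁) ≤ 1` and
`10⁷·L³·(CS·ε₁) ≤ 1` hold. [cite: Balaban1985Variational, Thm 1 p.279; (2) p.278] -/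
theorem symCentreRow_windows {L CS ε₁ : ℝ} (hL : 0 ≤ L) (hCS : 0 < CS) (hB : L ^ 3 * (3 * L) ≤ CS) (hε₁ : 0 ≤ ε₁)
    (hε : ε₁ ≤ (10 ^ 7 * L ^ 3 * CS)⁻¹) :
    10 ^ 7 * L ^ 3 * (L ^ 3 * (3 * L) * ε₁) ≤ 1 ∧ 10 ^ 7 * L ^ 3 * (CS * ε₁) ≤ 1 := by
  have hL3 : 0 ≤ L ^ 3 := pow_nonneg hL 3
  have hW : 0 ≤ 10 ^ 7 * L ^ 3 * CS := by positivity
  have hkey : 10 ^ 7 * L ^ 3 * (CS * ε₁) ≤ 1 := by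
    rcases eq_or_lt_of_le hW with h0 | hpos
    · have : 10 ^ 7 * L ^ 3 * (CS * ε₁) = (10 ^ 7 * L ^ 3 * CS) * ε₁ := by ring
      rw [this, ← h0, zero_mul]; exact zero_le_one
    · have h1 := mul_le_mul_of_nonneg_left hε hW
      rw [mul_inv_cancel₀ hpos.ne'] at h1
      calc 10 ^ 7 * L ^ 3 * (CS * ε₁) = 10 ^ 7 * L ^ 3 * CS * ε₁ := by ring
        _ ≤ 1 := h1
  refine ⟨?_, hkey⟩
  calc 10 ^ 7 * L ^ 3 * (L ^ 3 * (3 * L) * ε₁) ≤ 10 ^ 7 * L ^ 3 * (CS * ε₁) := by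
        apply mul_le_mul_of_nonneg_left _ (by positivity)
        exact mul_le_mul_of_nonneg_right hB hε₁
    _ ≤ 1 := hkey

/-! ## §1 The displayed row from a per-`L` supplier, generic lift letter -/

/-- ★★★ **«ROW-KNIT» — the displayed row `hSymCentre` (hSymCentre-R, opaque `Lift`, radius letter `CS`) FROM A PER-`L` DIAGONAL-LIFT SUPPLIER.**  Let
`Lift L i U₁` be any lift letter implied by the hLift text of record (`hLiftOf`).  Suppose (`hSupL`) that for every block size `L > 1` there are `aF, CF > 0`
such that for every member `F` (`F.L = L`), heights `n ≤ K`, every `0 < ε₁ ≤ aF` and every σ₃-DIAGONAL coarse `V′` all of whose `V′♭`-parallel sections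
are constant matrices commuting with `σ₃` (case A) with `PlaqSmall ε₁ V′`, a σ₃-diagonal `U₁ ∈ fibre V′` with `RegPr (CF·ε₁) U₁` is supplied.  Then the
display's row holds with `CS := max (L³·3L) CF` and `aS := min aF (min 2 (10⁷·L³·CS)⁻¹)`: for every `i : Idx L`, `0 < ε₁ ≤ aS`, `PlaqSmall ε₁ V`,
`RegPr (L³·3L·ε₁) U₀`, `U₀ ∈ fibre V` there is `U₁ ∈ fibre V` with `RegPr (CS·ε₁) U₁` and `Lift L i U₁` (frame ✓`exists_symCentre_of_diagonalLiftSupplier`).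
[cite: Balaban1985Variational, Thm 1 p.279, (2)-(7) p.278, (13)-(14) p.280; Balaban1985BackgroundPropagators, (3.21) p.394; Balaban1987RG1, (0.4) p.253] -/
theorem hSymCentreRow_of_diagonalLiftSupplierL
    (Lift : ∀ (L : ℕ) (i : Idx L), GaugeField (i.1.1.P i.1.2.2) 0 (Matrix.specialUnitaryGroup (Fin 2) ℂ) → Prop)
    (hLiftOf : ∀ (L : ℕ) (i : Idx L) (U₁ : GaugeField (i.1.1.P i.1.2.2) 0 (Matrix.specialUnitaryGroup (Fin 2) ℂ)),
      (∀ cf : Site (i.1.1.P i.1.2.2) (i.1.2.2 - i.1.2.1) → Matrix (Fin 2) (Fin 2) ℂ,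
        (∀ e : PBond (i.1.1.P i.1.2.2) (i.1.2.2 - i.1.2.1), cf e.src =
            ((emlIterU (i.1.2.2 - i.1.2.1) (bgUnits i.1.1 i.1.2.2 U₁) e : (Matrix (Fin 2) (Fin 2) ℂ)ˣ) : Matrix (Fin 2) (Fin 2) ℂ) * cf e.tgt *
            (((emlIterU (i.1.2.2 - i.1.2.1) (bgUnits i.1.1 i.1.2.2 U₁) e)⁻¹ : (Matrix (Fin 2) (Fin 2) ℂ)ˣ) : Matrix (Fin 2) (Fin 2) ℂ)) →
        ∃ l₀ : Site (i.1.1.P i.1.2.2) 0 → Matrix (Fin 2) (Fin 2) ℂ,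
          (∀ b' : PBond (i.1.1.P i.1.2.2) 0, l₀ b'.src =
            ((bgUnits i.1.1 i.1.2.2 U₁ b' : (Matrix (Fin 2) (Fin 2) ℂ)ˣ) : Matrix (Fin 2) (Fin 2) ℂ) * l₀ b'.tgt *
            (((bgUnits i.1.1 i.1.2.2 U₁ b')⁻¹ : (Matrix (Fin 2) (Fin 2) ℂ)ˣ) : Matrix (Fin 2) (Fin 2) ℂ)) ∧
          ∀ y : Site (i.1.1.P i.1.2.2) (i.1.2.2 - i.1.2.1), l₀ (embIter (i.1.2.2 - i.1.2.1) y) = cf y) →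
      Lift L i U₁)
    (hSupL : ∀ (L : ℕ), 1 < L → ∃ aF CF : ℝ, 0 < aF ∧ 0 < CF ∧ ∀ (F : T3Family), F.L = L → ∀ (n K : ℕ) (h : n ≤ K) (ε₁ : ℝ), 0 < ε₁ → ε₁ ≤ aF →
      ∀ V' : GaugeField (F.P n) 0 (Matrix.specialUnitaryGroup (Fin 2) ℂ),
        (∀ e : PBond (F.P n) 0, Commute ((V' e : Matrix.specialUnitaryGroup (Fin 2) ℂ) : Matrix (Fin 2) (Fin 2) ℂ) σ₃) →
        (∀ c : Site (F.P n) 0 → Matrix (Fin 2) (Fin 2) ℂ,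
          (∀ e : PBond (F.P n) 0, c e.src = ((unitsField (toUField V') e : (Matrix (Fin 2) (Fin 2) ℂ)ˣ) : Matrix (Fin 2) (Fin 2) ℂ) * c e.tgt *
            (((unitsField (toUField V') e)⁻¹ : (Matrix (Fin 2) (Fin 2) ℂ)ˣ) : Matrix (Fin 2) (Fin 2) ℂ)) →
          ∃ c₀ : Matrix (Fin 2) (Fin 2) ℂ, (∀ y, c y = c₀) ∧ Commute c₀ σ₃) →
        PlaqSmall ε₁ V' →
        ∃ U₁ : GaugeField (F.P K) 0 (Matrix.specialUnitaryGroup (Fin 2) ℂ), U₁ ∈ fibre F ℰp n K h V' ∧ RegPr F n K (CF * ε₁) U₁ ∧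
          ∀ b' : PBond (F.P K) 0, Commute ((U₁ b' : Matrix.specialUnitaryGroup (Fin 2) ℂ) : Matrix (Fin 2) (Fin 2) ℂ) σ₃) :
    ∀ (L : ℕ), 1 < L → ∃ aS CS : ℝ, 0 < aS ∧ (L : ℝ) ^ 3 * (3 * (L : ℝ)) ≤ CS ∧ ∀ (i : Idx L) (ε₁ : ℝ), 0 < ε₁ → ε₁ ≤ aS →
        ∀ (V : GaugeField (i.1.1.P i.1.2.1) 0 (Matrix.specialUnitaryGroup (Fin 2) ℂ)) (U₀ : GaugeField (i.1.1.P i.1.2.2) 0 (Matrix.specialUnitaryGroup (Fin 2) ℂ)),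
          PlaqSmall ε₁ V → RegPr i.1.1 i.1.2.1 i.1.2.2 ((L : ℝ) ^ 3 * (3 * (L : ℝ)) * ε₁) U₀ → U₀ ∈ fibre i.1.1 ℰp i.1.2.1 i.1.2.2 i.2.2.le V →
          ∃ U₁ : GaugeField (i.1.1.P i.1.2.2) 0 (Matrix.specialUnitaryGroup (Fin 2) ℂ),
            U₁ ∈ fibre i.1.1 ℰp i.1.2.1 i.1.2.2 i.2.2.le V ∧ RegPr i.1.1 i.1.2.1 i.1.2.2 (CS * ε₁) U₁ ∧ Lift L i U₁ := by
  intro L hL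
  obtain ⟨aF, CF, haF, hCF, hSup⟩ := hSupL L hL
  have hL0 : (0 : ℝ) ≤ (L : ℝ) := Nat.cast_nonneg L
  have hL1 : (1 : ℝ) < (L : ℝ) := by exact_mod_cast hL
  have hB : 0 < (L : ℝ) ^ 3 * (3 * (L : ℝ)) := by positivity
  have hCS0 : 0 < max ((L : ℝ) ^ 3 * (3 * (L : ℝ))) CF := lt_max_of_lt_left hB
  have hW0 : 0 < (10 ^ 7 * (L : ℝ) ^ 3 * max ((L : ℝ) ^ 3 * (3 * (L : ℝ))) CF)⁻¹ := by positivity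
  refine ⟨min aF (min 2 (10 ^ 7 * (L : ℝ) ^ 3 * max ((L : ℝ) ^ 3 * (3 * (L : ℝ))) CF)⁻¹), max ((L : ℝ) ^ 3 * (3 * (L : ℝ))) CF,
    lt_min haF (lt_min two_pos hW0), le_max_left _ _, ?_⟩
  intro i ε₁ hε₁ hε V U₀ hV hreg hfib
  have hεF : ε₁ ≤ aF := hε.trans (min_le_left _ _)
  have hε2 : ε₁ ≤ 2 := hε.trans ((min_le_right _ _).trans (min_le_left _ _))
  have hεW : ε₁ ≤ (10 ^ 7 * (L : ℝ) ^ 3 * max ((L : ℝ) ^ 3 * (3 * (L : ℝ))) CF)⁻¹ :=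
    hε.trans ((min_le_right _ _).trans (min_le_right _ _))
  obtain ⟨haW, ha'W⟩ := symCentreRow_windows hL0 hCS0 (le_max_left _ _) hε₁.le hεW
  have hFL : (i.1.1.L : ℝ) = (L : ℝ) := by exact_mod_cast i.2.1
  have ha : 0 < (L : ℝ) ^ 3 * (3 * (L : ℝ)) * ε₁ := mul_pos hB hε₁
  have haa' : (L : ℝ) ^ 3 * (3 * (L : ℝ)) * ε₁ ≤ max ((L : ℝ) ^ 3 * (3 * (L : ℝ))) CF * ε₁ :=
    mul_le_mul_of_nonneg_right (le_max_left _ _) hε₁.le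
  have hCFle : CF * ε₁ ≤ max ((L : ℝ) ^ 3 * (3 * (L : ℝ))) CF * ε₁ := mul_le_mul_of_nonneg_right (le_max_right _ _) hε₁.le
  obtain ⟨U₁, hfib₁, hreg₁, -, hLift₁⟩ := exists_symCentre_of_diagonalLiftSupplier i.1.1 i.2.2.le (b := 1) hε2 ha (by rw [hFL]; exact haW) haa'
    (by rw [hFL]; exact ha'W) one_pos
    (fun V' hdiag hA hV' => by
      obtain ⟨U₁, hfib₁, hreg₁, hU₁⟩ := hSup i.1.1 i.2.1 i.1.2.1 i.1.2.2 i.2.2.le ε₁ hε₁ hεF V' hdiag hA hV'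
      exact ⟨U₁, hfib₁, regPr_mono i.1.1 hCFle hreg₁, hU₁⟩)
    hV hfib hreg
  exact ⟨U₁, hfib₁, hreg₁, hLiftOf L i U₁ hLift₁⟩

/-- ★★ **«ROW-KNIT», §1-frame variant — the displayed row FROM A PER-`L` ABELIAN SUPPLIER THAT RETURNS THE LIFT CLAUSE.**  As
✓`hSymCentreRow_of_diagonalLiftSupplierL`, but the supplier returns `U₁ ∈ fibre V′ ∧ RegPr (CF·ε₁) U₁ ∧ ⟨hLift text at U₁⟩` (frame
✓`exists_symCentre_of_abelianSupplier`, ✓p675211 §1); no diagonality of `U₁` and no second window on `CF` are needed.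
[cite: Balaban1985Variational, Thm 1 p.279, (2)-(7) p.278, (13)-(14) p.280; Balaban1985BackgroundPropagators, (3.21) p.394] -/
theorem hSymCentreRow_of_abelianSupplierL
    (Lift : ∀ (L : ℕ) (i : Idx L), GaugeField (i.1.1.P i.1.2.2) 0 (Matrix.specialUnitaryGroup (Fin 2) ℂ) → Prop)
    (hLiftOf : ∀ (L : ℕ) (i : Idx L) (U₁ : GaugeField (i.1.1.P i.1.2.2) 0 (Matrix.specialUnitaryGroup (Fin 2) ℂ)),
      (∀ cf : Site (i.1.1.P i.1.2.2) (i.1.2.2 - i.1.2.1) → Matrix (Fin 2) (Fin 2) ℂ,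
        (∀ e : PBond (i.1.1.P i.1.2.2) (i.1.2.2 - i.1.2.1), cf e.src =
            ((emlIterU (i.1.2.2 - i.1.2.1) (bgUnits i.1.1 i.1.2.2 U₁) e : (Matrix (Fin 2) (Fin 2) ℂ)ˣ) : Matrix (Fin 2) (Fin 2) ℂ) * cf e.tgt *
            (((emlIterU (i.1.2.2 - i.1.2.1) (bgUnits i.1.1 i.1.2.2 U₁) e)⁻¹ : (Matrix (Fin 2) (Fin 2) ℂ)ˣ) : Matrix (Fin 2) (Fin 2) ℂ)) →
        ∃ l₀ : Site (i.1.1.P i.1.2.2) 0 → Matrix (Fin 2) (Fin 2) ℂ,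
          (∀ b' : PBond (i.1.1.P i.1.2.2) 0, l₀ b'.src =
            ((bgUnits i.1.1 i.1.2.2 U₁ b' : (Matrix (Fin 2) (Fin 2) ℂ)ˣ) : Matrix (Fin 2) (Fin 2) ℂ) * l₀ b'.tgt *
            (((bgUnits i.1.1 i.1.2.2 U₁ b')⁻¹ : (Matrix (Fin 2) (Fin 2) ℂ)ˣ) : Matrix (Fin 2) (Fin 2) ℂ)) ∧
          ∀ y : Site (i.1.1.P i.1.2.2) (i.1.2.2 - i.1.2.1), l₀ (embIter (i.1.2.2 - i.1.2.1) y) = cf y) →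
      Lift L i U₁)
    (hSupL : ∀ (L : ℕ), 1 < L → ∃ aF CF : ℝ, 0 < aF ∧ 0 < CF ∧ ∀ (F : T3Family), F.L = L → ∀ (n K : ℕ) (h : n ≤ K) (ε₁ : ℝ), 0 < ε₁ → ε₁ ≤ aF →
      ∀ V' : GaugeField (F.P n) 0 (Matrix.specialUnitaryGroup (Fin 2) ℂ),
        (∀ e : PBond (F.P n) 0, Commute ((V' e : Matrix.specialUnitaryGroup (Fin 2) ℂ) : Matrix (Fin 2) (Fin 2) ℂ) σ₃) →
        (∀ c : Site (F.P n) 0 → Matrix (Fin 2) (Fin 2) ℂ,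
          (∀ e : PBond (F.P n) 0, c e.src = ((unitsField (toUField V') e : (Matrix (Fin 2) (Fin 2) ℂ)ˣ) : Matrix (Fin 2) (Fin 2) ℂ) * c e.tgt *
            (((unitsField (toUField V') e)⁻¹ : (Matrix (Fin 2) (Fin 2) ℂ)ˣ) : Matrix (Fin 2) (Fin 2) ℂ)) →
          ∃ c₀ : Matrix (Fin 2) (Fin 2) ℂ, (∀ y, c y = c₀) ∧ Commute c₀ σ₃) →
        PlaqSmall ε₁ V' →
        ∃ U₁ : GaugeField (F.P K) 0 (Matrix.specialUnitaryGroup (Fin 2) ℂ), U₁ ∈ fibre F ℰp n K h V' ∧ RegPr F n K (CF * ε₁) U₁ ∧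
          ∀ cf : Site (F.P K) (K - n) → Matrix (Fin 2) (Fin 2) ℂ,
            (∀ e : PBond (F.P K) (K - n), cf e.src = ((emlIterU (K - n) (bgUnits F K U₁) e : (Matrix (Fin 2) (Fin 2) ℂ)ˣ) : Matrix (Fin 2) (Fin 2) ℂ) * cf e.tgt *
              (((emlIterU (K - n) (bgUnits F K U₁) e)⁻¹ : (Matrix (Fin 2) (Fin 2) ℂ)ˣ) : Matrix (Fin 2) (Fin 2) ℂ)) →
            ∃ l₀ : Site (F.P K) 0 → Matrix (Fin 2) (Fin 2) ℂ,
              (∀ b' : PBond (F.P K) 0, l₀ b'.src = ((bgUnits F K U₁ b' : (Matrix (Fin 2) (Fin 2) ℂ)ˣ) : Matrix (Fin 2) (Fin 2) ℂ) * l₀ b'.tgt *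
                (((bgUnits F K U₁ b')⁻¹ : (Matrix (Fin 2) (Fin 2) ℂ)ˣ) : Matrix (Fin 2) (Fin 2) ℂ)) ∧
              ∀ y : Site (F.P K) (K - n), l₀ (embIter (K - n) y) = cf y) :
    ∀ (L : ℕ), 1 < L → ∃ aS CS : ℝ, 0 < aS ∧ (L : ℝ) ^ 3 * (3 * (L : ℝ)) ≤ CS ∧ ∀ (i : Idx L) (ε₁ : ℝ), 0 < ε₁ → ε₁ ≤ aS →
        ∀ (V : GaugeField (i.1.1.P i.1.2.1) 0 (Matrix.specialUnitaryGroup (Fin 2) ℂ)) (U₀ : GaugeField (i.1.1.P i.1.2.2) 0 (Matrix.specialUnitaryGroup (Fin 2) ℂ)),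
          PlaqSmall ε₁ V → RegPr i.1.1 i.1.2.1 i.1.2.2 ((L : ℝ) ^ 3 * (3 * (L : ℝ)) * ε₁) U₀ → U₀ ∈ fibre i.1.1 ℰp i.1.2.1 i.1.2.2 i.2.2.le V →
          ∃ U₁ : GaugeField (i.1.1.P i.1.2.2) 0 (Matrix.specialUnitaryGroup (Fin 2) ℂ),
            U₁ ∈ fibre i.1.1 ℰp i.1.2.1 i.1.2.2 i.2.2.le V ∧ RegPr i.1.1 i.1.2.1 i.1.2.2 (CS * ε₁) U₁ ∧ Lift L i U₁ := by
  intro L hL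
  obtain ⟨aF, CF, haF, hCF, hSup⟩ := hSupL L hL
  have hL0 : (0 : ℝ) ≤ (L : ℝ) := Nat.cast_nonneg L
  have hL1 : (1 : ℝ) < (L : ℝ) := by exact_mod_cast hL
  have hB : 0 < (L : ℝ) ^ 3 * (3 * (L : ℝ)) := by positivity
  have hCS0 : 0 < max ((L : ℝ) ^ 3 * (3 * (L : ℝ))) CF := lt_max_of_lt_left hB
  have hW0 : 0 < (10 ^ 7 * (L : ℝ) ^ 3 * max ((L : ℝ) ^ 3 * (3 * (L : ℝ))) CF)⁻¹ := by positivity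
  refine ⟨min aF (min 2 (10 ^ 7 * (L : ℝ) ^ 3 * max ((L : ℝ) ^ 3 * (3 * (L : ℝ))) CF)⁻¹), max ((L : ℝ) ^ 3 * (3 * (L : ℝ))) CF,
    lt_min haF (lt_min two_pos hW0), le_max_left _ _, ?_⟩
  intro i ε₁ hε₁ hε V U₀ hV hreg hfib
  have hεF : ε₁ ≤ aF := hε.trans (min_le_left _ _)
  have hε2 : ε₁ ≤ 2 := hε.trans ((min_le_right _ _).trans (min_le_left _ _))
  have hεW : ε₁ ≤ (10 ^ 7 * (L : ℝ) ^ 3 * max ((L : ℝ) ^ 3 * (3 * (L : ℝ))) CF)⁻¹ :=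
    hε.trans ((min_le_right _ _).trans (min_le_right _ _))
  obtain ⟨haW, -⟩ := symCentreRow_windows hL0 hCS0 (le_max_left _ _) hε₁.le hεW
  have hFL : (i.1.1.L : ℝ) = (L : ℝ) := by exact_mod_cast i.2.1
  have ha : 0 < (L : ℝ) ^ 3 * (3 * (L : ℝ)) * ε₁ := mul_pos hB hε₁
  have haa' : (L : ℝ) ^ 3 * (3 * (L : ℝ)) * ε₁ ≤ max ((L : ℝ) ^ 3 * (3 * (L : ℝ))) CF * ε₁ :=
    mul_le_mul_of_nonneg_right (le_max_left _ _) hε₁.le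
  have hCFle : CF * ε₁ ≤ max ((L : ℝ) ^ 3 * (3 * (L : ℝ))) CF * ε₁ := mul_le_mul_of_nonneg_right (le_max_right _ _) hε₁.le
  obtain ⟨U₁, hfib₁, hreg₁, -, hLift₁⟩ := exists_symCentre_of_abelianSupplier i.1.1 i.2.2.le (b := 1) hε2 ha (by rw [hFL]; exact haW) haa' one_pos
    (fun V' hdiag hA hV' => by
      obtain ⟨U₁, hfib₁, hreg₁, hU₁⟩ := hSup i.1.1 i.2.1 i.1.2.1 i.1.2.2 i.2.2.le ε₁ hε₁ hεF V' hdiag hA hV'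
      exact ⟨U₁, hfib₁, regPr_mono i.1.1 hCFle hreg₁, hU₁⟩)
    hV hfib hreg
  exact ⟨U₁, hfib₁, hreg₁, hLiftOf L i U₁ hLift₁⟩

/-! ## §2 The row at the lift letter of record -/

/-- ★★★ **«ROW-KNIT» AT THE LIFT LETTER OF RECORD.**  ✓`hSymCentreRow_of_diagonalLiftSupplierL` at `Lift L i U₁ :=` the hLift text of record («every
`Ū₁`-parallel coarse section on `T^{(K−n)}` lifts to a `U₁`-parallel fine section agreeing with it at the block representatives», ✓p665243 :277–282),
bridge `id`: the displayed row `hSymCentre` of the EX display of record, as the EX knit instantiates it, follows from the per-`L` diagonal-lift supplier.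
[cite: Balaban1985Variational, Thm 1 p.279, (2)-(7) p.278, (13)-(14) p.280; Balaban1985BackgroundPropagators, (3.21) p.394; Balaban1987RG1, (0.4) p.253] -/
theorem hSymCentreRow_of_diagonalLiftSupplierL_record
    (hSupL : ∀ (L : ℕ), 1 < L → ∃ aF CF : ℝ, 0 < aF ∧ 0 < CF ∧ ∀ (F : T3Family), F.L = L → ∀ (n K : ℕ) (h : n ≤ K) (ε₁ : ℝ), 0 < ε₁ → ε₁ ≤ aF →
      ∀ V' : GaugeField (F.P n) 0 (Matrix.specialUnitaryGroup (Fin 2) ℂ),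
        (∀ e : PBond (F.P n) 0, Commute ((V' e : Matrix.specialUnitaryGroup (Fin 2) ℂ) : Matrix (Fin 2) (Fin 2) ℂ) σ₃) →
        (∀ c : Site (F.P n) 0 → Matrix (Fin 2) (Fin 2) ℂ,
          (∀ e : PBond (F.P n) 0, c e.src = ((unitsField (toUField V') e : (Matrix (Fin 2) (Fin 2) ℂ)ˣ) : Matrix (Fin 2) (Fin 2) ℂ) * c e.tgt *
            (((unitsField (toUField V') e)⁻¹ : (Matrix (Fin 2) (Fin 2) ℂ)ˣ) : Matrix (Fin 2) (Fin 2) ℂ)) →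
          ∃ c₀ : Matrix (Fin 2) (Fin 2) ℂ, (∀ y, c y = c₀) ∧ Commute c₀ σ₃) →
        PlaqSmall ε₁ V' →
        ∃ U₁ : GaugeField (F.P K) 0 (Matrix.specialUnitaryGroup (Fin 2) ℂ), U₁ ∈ fibre F ℰp n K h V' ∧ RegPr F n K (CF * ε₁) U₁ ∧
          ∀ b' : PBond (F.P K) 0, Commute ((U₁ b' : Matrix.specialUnitaryGroup (Fin 2) ℂ) : Matrix (Fin 2) (Fin 2) ℂ) σ₃) :
    ∀ (L : ℕ), 1 < L → ∃ aS CS : ℝ, 0 < aS ∧ (L : ℝ) ^ 3 * (3 * (L : ℝ)) ≤ CS ∧ ∀ (i : Idx L) (ε₁ : ℝ), 0 < ε₁ → ε₁ ≤ aS →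
        ∀ (V : GaugeField (i.1.1.P i.1.2.1) 0 (Matrix.specialUnitaryGroup (Fin 2) ℂ)) (U₀ : GaugeField (i.1.1.P i.1.2.2) 0 (Matrix.specialUnitaryGroup (Fin 2) ℂ)),
          PlaqSmall ε₁ V → RegPr i.1.1 i.1.2.1 i.1.2.2 ((L : ℝ) ^ 3 * (3 * (L : ℝ)) * ε₁) U₀ → U₀ ∈ fibre i.1.1 ℰp i.1.2.1 i.1.2.2 i.2.2.le V →
          ∃ U₁ : GaugeField (i.1.1.P i.1.2.2) 0 (Matrix.specialUnitaryGroup (Fin 2) ℂ),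
            U₁ ∈ fibre i.1.1 ℰp i.1.2.1 i.1.2.2 i.2.2.le V ∧ RegPr i.1.1 i.1.2.1 i.1.2.2 (CS * ε₁) U₁ ∧
            ∀ cf : Site (i.1.1.P i.1.2.2) (i.1.2.2 - i.1.2.1) → Matrix (Fin 2) (Fin 2) ℂ,
              (∀ e : PBond (i.1.1.P i.1.2.2) (i.1.2.2 - i.1.2.1), cf e.src =
                  ((emlIterU (i.1.2.2 - i.1.2.1) (bgUnits i.1.1 i.1.2.2 U₁) e : (Matrix (Fin 2) (Fin 2) ℂ)ˣ) : Matrix (Fin 2) (Fin 2) ℂ) * cf e.tgt *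
                  (((emlIterU (i.1.2.2 - i.1.2.1) (bgUnits i.1.1 i.1.2.2 U₁) e)⁻¹ : (Matrix (Fin 2) (Fin 2) ℂ)ˣ) : Matrix (Fin 2) (Fin 2) ℂ)) →
              ∃ l₀ : Site (i.1.1.P i.1.2.2) 0 → Matrix (Fin 2) (Fin 2) ℂ,
                (∀ b' : PBond (i.1.1.P i.1.2.2) 0, l₀ b'.src =
                  ((bgUnits i.1.1 i.1.2.2 U₁ b' : (Matrix (Fin 2) (Fin 2) ℂ)ˣ) : Matrix (Fin 2) (Fin 2) ℂ) * l₀ b'.tgt *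
                  (((bgUnits i.1.1 i.1.2.2 U₁ b')⁻¹ : (Matrix (Fin 2) (Fin 2) ℂ)ˣ) : Matrix (Fin 2) (Fin 2) ℂ)) ∧
                ∀ y : Site (i.1.1.P i.1.2.2) (i.1.2.2 - i.1.2.1), l₀ (embIter (i.1.2.2 - i.1.2.1) y) = cf y :=
  hSymCentreRow_of_diagonalLiftSupplierL _ (fun _ _ _ h => h) hSupL

end T3

end Summit.QuantumFields.YangMills.Theorems.Prop7NestedMeanParallelLiftDiagGauge

end
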